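import Summits.QuantumAdvantage.QuantumAdvantage.Theses.SymplecticPurity
import Summits.QuantumAdvantage.QuantumAdvantage.Theorems.SymplecticPurityGaussianDegreeBoundWords
import Summits.QuantumAdvantage.QuantumAdvantage.Theorems.SymplecticPurityGaussianDegreeBoundBessel
import Summits.QuantumAdvantage.QuantumAdvantage.Theorems.SymplecticPurityGaussianDegreeBoundSpectralMass

/-!
# `SymplecticPurity.GaussianDegreeBound` (stmt-QuantumAdvantage-9838) — MATCHGATE FRAMES

PROOF of the support item `GaussianDegreeBound` of route SymplecticPurity (post-crux prover,
2026-08-16): for a unit `ε`-flat vector `ψ` on `n` qubits (`|⟨ψ|S|ψ⟩| ≤ ε` for every Pauli string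
`S ≠ I`), every unitary `U` that is fermionic Gaussian in the tree's Jordan–Wigner frame
(`U c_p U† = Σ_q R_{pq} c_q`, `R Rᵀ = 1`, `c = majorana`) and every `d ≤ n`, the purity of the
first `d` qubits of `Uψ` (the Theses decl's literal 4-fold agreement sum) is at most
`2^{-d} (1 + ε² Σ_{k=1}^{2d} C(2n,k))`.

## Proof (filtration + Bessel; no compound matrices)
1. purity = spectral mass: `‖Σ⁽⁴⁾‖ = 2^{-d} Σ_{S ∈ 𝒫^{<d}⊗I} |⟨Uψ|S|Uψ⟩|²` (`gdb_norm_cutSum_eq`, file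
   `…SpectralMass`), and `⟨Uψ|S|Uψ⟩ = ⟨ψ|U†SU|ψ⟩`.
2. Jordan–Wigner keeps initial blocks local: each such `S` is a unit phase times a Majorana WORD of
   length `≤ 2d` (`exists_word_of_low`, file `…Words`).
3. `U† c_q U = Σ_p R_{pq} c_p`, so `U†` maps words of length `m` into the span of words of length `m`
   (`star_mul_word_mul_mem_span`, file `…Bessel`); every word is a unit phase times the Pauli string
   of the SET of its odd-multiplicity letters (`word_eq_smul_pauliString`,
   `exists_finset_sum_eq_list_sum`), so all `U† S U` lie in the span of the strings `σ_T`, `T` ranging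
   over a set `𝒯` of strings with `|𝒯 ∖ {I}| ≤ Σ_{k=1}^{2d} C(2n,k)` (`card_image_erase_le`).
4. The `U† S U` are Hilbert–Schmidt orthogonal (norm² `2ⁿ`), as are the `σ_T`; Bessel for the
   functional `A ↦ ⟨ψ|A|ψ⟩` (`sum_norm_sq_le_of_mem_span`) gives
   `Σ_S |⟨ψ|U†SU|ψ⟩|² ≤ Σ_{T ∈ 𝒯} |⟨ψ|σ_T|ψ⟩|² ≤ 1 + ε² |𝒯 ∖ {I}|`.
-/

set_option linter.dupNamespace false -- D-0017: single-problem summit ⇒ `QuantumAdvantage.QuantumAdvantage` by design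

noncomputable section

namespace Summit.QuantumAdvantage.QuantumAdvantage.Theorems.SymplecticPurity

open Matrix Finset
open scoped InnerProductSpace
open Literature.Computability.QuantumComplexity Literature.Computability.Cryptography

/-- Expectations transform covariantly: `⟨Uχ|S|Uχ⟩ = ⟨χ|U† S U|χ⟩`. -/
theorem gdb_star_mulVec_dotProduct_pauliString_mulVec {n : ℕ} (U : Matrix (QReg n) (QReg n) ℂ)
    (χ : QReg n → ℂ) (S : Fin n → Pauli) :
    star (U *ᵥ χ) ⬝ᵥ (pauliString S *ᵥ (U *ᵥ χ)) = star χ ⬝ᵥ ((star U * pauliString S * U) *ᵥ χ) := by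
  rw [Matrix.star_mulVec, ← Matrix.dotProduct_mulVec, Matrix.mulVec_mulVec, Matrix.mulVec_mulVec,
    ← Matrix.star_eq_conjTranspose, Matrix.mul_assoc]

/-- The expectation of the identity string in a unit vector is `1` in norm:
`|⟨ψ|I|ψ⟩|² = 1` when `normSq ψ = 1`. -/
theorem gdb_norm_star_dotProduct_one_mulVec {n : ℕ} {ψ : QReg n → ℂ} (hψ : normSq ψ = 1) :
    ‖star ψ ⬝ᵥ (pauliString (fun _ : Fin n => Pauli.I) *ᵥ ψ)‖ ^ 2 = 1 := by
  rw [pauliString_const_I, Matrix.one_mulVec]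
  have h : star ψ ⬝ᵥ ψ = ((normSq ψ : ℝ) : ℂ) := by
    rw [normSq, Complex.ofReal_sum, dotProduct]
    refine Finset.sum_congr rfl fun x _ => ?_
    rw [Pi.star_apply, Complex.star_def, Complex.conj_mul', Complex.ofReal_pow]
  rw [h, hψ, Complex.ofReal_one, norm_one, one_pow]

/-- Flatness bound on a set of strings: for a unit `ε`-flat `ψ` and any finite set `𝒯` of strings,
`Σ_{T ∈ 𝒯} |⟨ψ|σ_T|ψ⟩|² ≤ 1 + ε² · |𝒯 ∖ {I}|`. -/
theorem gdb_sum_norm_sq_le_one_add {n : ℕ} {ε : ℝ} {ψ : QReg n → ℂ} (hψ : normSq ψ = 1)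
    (hflat : ∀ S : Fin n → Pauli, S ≠ (fun _ => Pauli.I) → ‖star ψ ⬝ᵥ (pauliString S *ᵥ ψ)‖ ≤ ε)
    (𝒯 : Finset (Fin n → Pauli)) :
    ∑ T ∈ 𝒯, ‖star ψ ⬝ᵥ (pauliString T *ᵥ ψ)‖ ^ 2 ≤
      1 + ε ^ 2 * ((𝒯.erase (fun _ => Pauli.I)).card : ℝ) := by
  classical
  have hrest : ∑ T ∈ 𝒯.erase (fun _ => Pauli.I), ‖star ψ ⬝ᵥ (pauliString T *ᵥ ψ)‖ ^ 2 ≤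
      ε ^ 2 * ((𝒯.erase (fun _ => Pauli.I)).card : ℝ) := by
    rw [mul_comm]
    have h := Finset.sum_le_card_nsmul (𝒯.erase (fun _ => Pauli.I))
      (fun T => ‖star ψ ⬝ᵥ (pauliString T *ᵥ ψ)‖ ^ 2) (ε ^ 2) (fun T hT => by
        have hne : T ≠ fun _ => Pauli.I := (Finset.mem_erase.1 hT).1
        exact pow_le_pow_left₀ (norm_nonneg _) (hflat T hne) 2)
    rwa [nsmul_eq_mul] at h
  by_cases hI : (fun _ => Pauli.I) ∈ 𝒯
  · rw [← Finset.add_sum_erase 𝒯 _ hI, gdb_norm_star_dotProduct_one_mulVec hψ]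
    linarith
  · have he : 𝒯.erase (fun _ => Pauli.I) = 𝒯 := Finset.erase_eq_of_notMem hI
    rw [he] at hrest ⊢
    linarith

/-- **`GaussianDegreeBound`** (stmt-QuantumAdvantage-9838): in a fixed Jordan–Wigner frame no
fermionic Gaussian unitary lowers the purity-deficit of an initial block of an `ε`-flat state below
the binomial count — `Tr ρ²_{[d]}(Uψ) ≤ 2^{-d}(1 + ε² Σ_{k=1}^{2d} C(2n,k))`. -/
theorem GaussianDegreeBound_proof :
    Summit.QuantumAdvantage.QuantumAdvantage.Theses.SymplecticPurity.GaussianDegreeBound := by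
  intro n ε ψ hψ hflat U hU hGauss d hd
  classical
  obtain ⟨R, hR, hG⟩ := hGauss
  -- Step 1: purity = spectral mass; reduce to a bound on the spectral mass of `Uψ` on the cut
  rw [gdb_norm_cutSum_eq (U *ᵥ ψ) hd, div_eq_inv_mul]
  refine mul_le_mul_of_nonneg_left ?_ (inv_nonneg.2 (pow_nonneg zero_le_two d))
  -- notation
  set L : Finset (Fin n → Pauli) := stringsOn (Finset.univ.filter fun i : Fin n => i.val < d) with hL
  -- the bit encoding of the Pauli letters (strings are a group modulo phases)
  set β : Pauli → ZMod 2 × ZMod 2 := fun P =>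
    ((if P = Pauli.X ∨ P = Pauli.Y then 1 else 0), (if P = Pauli.Z ∨ P = Pauli.Y then 1 else 0)) with hβ
  set π : ZMod 2 × ZMod 2 → Pauli := fun v =>
    if v = (0, 0) then Pauli.I else if v = (1, 0) then Pauli.X else if v = (1, 1) then Pauli.Y
      else Pauli.Z with hπ
  have hπβ : ∀ P, π (β P) = P := by intro P; cases P <;> decide
  have hβπ : ∀ v, β (π v) = v := by decide
  have hmul : ∀ P Q : Pauli, β (P.letterMul Q) = β P + β Q := by
    intro P Q; cases P <;> cases Q <;> decide
  have hβI : β Pauli.I = 0 := by decide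
  have h2 : ∀ x : Fin n → ZMod 2 × ZMod 2, x + x = 0 := fun x =>
    funext fun i => (by decide : ∀ v : ZMod 2 × ZMod 2, v + v = 0) (x i)
  -- the set of strings carrying all conjugated low strings
  set G : Finset (Fin n × Bool) → (Fin n → Pauli) := fun T i =>
    π (∑ q ∈ T, β (majoranaWord n q.1 q.2 i)) with hGdef
  set 𝒯 : Finset (Fin n → Pauli) :=
    ((Finset.univ : Finset (Finset (Fin n × Bool))).filter (fun T => T.card ≤ 2 * d)).image G
    with h𝒯
  have hG0 : G ∅ = fun _ => Pauli.I := by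
    funext i
    simp only [hGdef, Finset.sum_empty]
    rw [← hβI, hπβ]
  -- Step 2–3: every `U† σ_S U`, `S` low, lies in the span of the strings of `𝒯`
  have hq := star_mul_majorana_mul hU hR hG
  have hmemM : ∀ S ∈ L, star U * pauliString S * U ∈
      Submodule.span ℂ (pauliString '' (↑𝒯 : Set (Fin n → Pauli))) := by
    intro S hS
    obtain ⟨w, c, hw, -, hSw⟩ := exists_word_of_low hd S (fun i hi => gdb_eq_I_of_mem_stringsOn_low hS i hi)
    rw [hSw, Matrix.mul_smul, Matrix.smul_mul]
    refine Submodule.smul_mem _ _ ((Submodule.span_le.2 ?_) (star_mul_word_mul_mem_span hU hq w))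
    rintro _ ⟨w', hw', rfl⟩
    obtain ⟨c', -, hw'eq⟩ := word_eq_smul_pauliString β π hπβ hβπ hmul hβI w'
    rw [hw'eq]
    refine Submodule.smul_mem _ _ (Submodule.subset_span ⟨_, ?_, rfl⟩)
    obtain ⟨T, hTcard, hTsum⟩ := exists_finset_sum_eq_list_sum h2 w'
    have hGT : (fun i => π ((w'.map fun q => fun i => β (majoranaWord n q.1 q.2 i)).sum i)) = G T := by
      funext i
      rw [hTsum, Finset.sum_apply]
    rw [hGT, Finset.mem_coe, h𝒯]
    refine Finset.mem_image_of_mem G (Finset.mem_filter.2 ⟨Finset.mem_univ _, ?_⟩)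
    rw [hw'] at hTcard
    exact hTcard.trans hw
  -- Step 4: Bessel in `EuclideanSpace ℂ (QReg n × QReg n)`
  set Φ : Matrix (QReg n) (QReg n) ℂ ≃ₗ[ℂ] EuclideanSpace ℂ (QReg n × QReg n) :=
    (LinearEquiv.curry ℂ ℂ (QReg n) (QReg n)).symm ≪≫ₗ
      (WithLp.linearEquiv 2 ℂ (QReg n × QReg n → ℂ)).symm with hΦdef
  have hΦ : ∀ (A : Matrix (QReg n) (QReg n) ℂ) (p : QReg n × QReg n), Φ A p = A p.1 p.2 :=
    fun _ _ => rfl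
  set fM : Matrix (QReg n) (QReg n) ℂ →ₗ[ℂ] ℂ :=
    { toFun := fun A => star ψ ⬝ᵥ (A *ᵥ ψ)
      map_add' := fun A B => by rw [Matrix.add_mulVec, dotProduct_add]
      map_smul' := fun c A => by rw [Matrix.smul_mulVec, dotProduct_smul, RingHom.id_apply] }
    with hfM
  have hfM_apply : ∀ A, fM A = star ψ ⬝ᵥ (A *ᵥ ψ) := fun _ => rfl
  set f : EuclideanSpace ℂ (QReg n × QReg n) →ₗ[ℂ] ℂ := fM ∘ₗ Φ.symm.toLinearMap with hf
  have hfΦ : ∀ A, f (Φ A) = star ψ ⬝ᵥ (A *ᵥ ψ) := fun A => by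
    rw [hf, LinearMap.comp_apply, LinearEquiv.coe_toLinearMap, LinearEquiv.symm_apply_apply]
    exact hfM_apply A
  set u : ↥L → EuclideanSpace ℂ (QReg n × QReg n) := fun S => Φ (star U * pauliString S * U) with hu
  set b : ↥𝒯 → EuclideanSpace ℂ (QReg n × QReg n) := fun T => Φ (pauliString T) with hb
  have hN : (0 : ℝ) < (2 : ℝ) ^ n := by positivity
  have huo : ∀ i j : ↥L, ⟪u i, u j⟫_ℂ = if i = j then (((2 : ℝ) ^ n : ℝ) : ℂ) else 0 := by
    intro i j
    rw [hu, inner_conj_pauliString hU Φ hΦ]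
    push_cast
    by_cases h : i = j
    · rw [if_pos h, if_pos (congrArg Subtype.val h)]
    · rw [if_neg h, if_neg (fun h' => h (Subtype.ext h'))]
  have hbo : ∀ k l : ↥𝒯, ⟪b k, b l⟫_ℂ = if k = l then (((2 : ℝ) ^ n : ℝ) : ℂ) else 0 := by
    intro k l
    rw [hb, inner_pauliString Φ hΦ]
    push_cast
    by_cases h : k = l
    · rw [if_pos h, if_pos (congrArg Subtype.val h)]
    · rw [if_neg h, if_neg (fun h' => h (Subtype.ext h'))]
  have hmem : ∀ i : ↥L, u i ∈ Submodule.span ℂ (Set.range b) := by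
    intro i
    have h1 : Φ (star U * pauliString i * U) ∈
        (Submodule.span ℂ (pauliString '' (↑𝒯 : Set (Fin n → Pauli)))).map Φ.toLinearMap :=
      Submodule.mem_map_of_mem (hmemM i i.2)
    rw [Submodule.map_span] at h1
    refine Submodule.span_mono ?_ h1
    rintro _ ⟨_, ⟨T, hT, rfl⟩, rfl⟩
    exact ⟨⟨T, hT⟩, rfl⟩
  have bessel := sum_norm_sq_le_of_mem_span hN u b huo hbo hmem f
  -- assemble
  calc ∑ S ∈ L, ‖star (U *ᵥ ψ) ⬝ᵥ (pauliString S *ᵥ (U *ᵥ ψ))‖ ^ 2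
      = ∑ i : ↥L, ‖f (u i)‖ ^ 2 := by
        rw [← Finset.sum_coe_sort]
        refine Finset.sum_congr rfl fun i _ => ?_
        rw [gdb_star_mulVec_dotProduct_pauliString_mulVec, hu, hfΦ]
    _ ≤ ∑ k : ↥𝒯, ‖f (b k)‖ ^ 2 := bessel
    _ = ∑ T ∈ 𝒯, ‖star ψ ⬝ᵥ (pauliString T *ᵥ ψ)‖ ^ 2 := by
        rw [← Finset.sum_coe_sort 𝒯]
        refine Finset.sum_congr rfl fun k _ => ?_
        rw [hb, hfΦ]
    _ ≤ 1 + ε ^ 2 * ((𝒯.erase (fun _ => Pauli.I)).card : ℝ) := gdb_sum_norm_sq_le_one_add hψ hflat 𝒯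
    _ ≤ 1 + ε ^ 2 * ∑ k ∈ Finset.Icc 1 (2 * d), ((2 * n).choose k : ℝ) := by
        have hc := card_image_erase_le n (2 * d) G
        rw [hG0] at hc
        have hc' : (((𝒯.erase (fun _ => Pauli.I)).card : ℕ) : ℝ) ≤
            ((∑ k ∈ Finset.Icc 1 (2 * d), (2 * n).choose k : ℕ) : ℝ) := by
          rw [h𝒯]; exact_mod_cast hc
        push_cast at hc'
        nlinarith [sq_nonneg ε]

end Summit.QuantumAdvantage.QuantumAdvantage.Theorems.SymplecticPurity

end
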